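import Literature.Computability.Cryptography.HallgrenClassGroupBlockFP
import HarnessLib

/-!
# Hallgren 2005 / class numbers under GRH — the block of Kitaev's class-group family: the clean
# reversible compilation of `clBlockFn`, its semantics, and "the work register separates exactly
# the trial forms"

Topic `Literature/Computability/Cryptography`; proof companion of `HallgrenClassGroupAssembly.lean`
(named fact `Hallgren2005.subgroupOrder_qsolvable`, Kitaev 1995, §4). Definitions and theorems; no
named fact. Sequel of `HallgrenClassGroupBlockFP.lean` (`clBlockFn ∈ FP`, `clBlockFn_wellFormed`,
`trialFormL_eq_trialForm`) and the class-group twin of the §Block part of `ShorDiscreteLogBlock.lean`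
(whose generic lemmas from `ShorModExpBlock.lean` — `liftW_tri`, `liftW_coinInput` — are reused):

* the block machine `MC` (`RevClean.exists_outputsWithin_pow_of_mem_FP`), the layout
  (`dataNC ℓ = ℓ + clNumControls ℓ` data wires, no suffix, `mWC ℓ` work wires), **the block `VC ℓ`** —
  the exact Clifford+T compilation (`revCompile`, Nielsen–Chuang Fig. 4.9) of Bennett's
  compute–copy–uncompute block `RevClean.cleanOps` (Kitaev 1995, §2.2 Lemma 1) of `MC`,
  `VC_isOracleFree`;
* **semantics** `VC_mulVec_basisState`: `VC |w⟩|c⟩|0^{mWC}⟩ = |w⟩|c⟩|resOfC w c⟩`;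
* **`resOf_eq_iff`**: on an instance `(d, L)` the work register determines and is determined by the
  trial forms `trialForm d L ℓ c t` (`t < clTrials ℓ`), and the packaged **`block_spec`** — exactly the
  block hypotheses of `HallgrenClassGroupQuantumKernel.kernelProb_clOrderEst_ge`.

## References

* A. Yu. Kitaev, *Quantum measurements and the Abelian Stabilizer Problem*, arXiv:quant-ph/9511026
  (1995), §2.2 Lemma 1 (garbage removal), §4 p. 15 [Kitaev1995].
* C. H. Bennett, *Logical reversibility of computation*, IBM J. Res. Develop. 17 (1973), §2 [folklore].
* M. A. Nielsen, I. L. Chuang, *Quantum Computation and Quantum Information*, CUP 2010, §3.2.5, §4.3 [folklore].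
-/

noncomputable section

namespace Literature.Computability.Cryptography.Hallgren2005

namespace ClBlock

open _root_.Computability Complexity QuantumComplexity QuantumComplexity.RevClean QuantumComplexity.RevSim Kitaev1995 Matrix Finset
  ClBlockFP Literature.Computability.Complexity.CodeFP

/-- A polynomial-time machine of `clBlockFn` with a time bound of the shape `(n+2)^e`. [folklore] -/
theorem exists_blockMachine : ∃ q : (_ : ℕ) × Turing.TM2ComputableAux Bool Bool,
    ∀ u : List Bool, q.2.OutputsWithin u (clBlockFn u) (Tn q.1 u.length) := by
  obtain ⟨e, M, h⟩ := exists_outputsWithin_pow_of_mem_FP clBlockFn_mem_FP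
  exact ⟨⟨e, M⟩, h⟩

/-- The exponent of the time bound of the block machine. [folklore] -/
def eC : ℕ := (Classical.choose exists_blockMachine).1

/-- **The block machine** (a `TM2` machine computing `clBlockFn` within `(n+2)^{eC}` steps). [folklore] -/
def MC : Turing.TM2ComputableAux Bool Bool := (Classical.choose exists_blockMachine).2

/-- The block machine computes `clBlockFn` within its time bound. [folklore] -/
theorem MC_outputsWithin (u : List Bool) : MC.OutputsWithin u (clBlockFn u) (Tn eC u.length) :=
  Classical.choose_spec exists_blockMachine u

/-- Data wires (= tableau input, no suffix): the instance `w` and the controls `c`. [folklore] -/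
def dataNC (ℓ : ℕ) : ℕ := ℓ + clNumControls ℓ

/-- The total number of wires of the block. [folklore] -/
def totNC (ℓ : ℕ) : ℕ := width eC MC (dataNC ℓ)

/-- The number of work wires of the block. [folklore] -/
def mWC (ℓ : ℕ) : ℕ := totNC ℓ - dataNC ℓ

/-- The data wires lie before the work wires. [folklore] -/
theorem dataN_le_totN (ℓ : ℕ) : dataNC ℓ ≤ totNC ℓ := (le_NN (e := eC) (M := MC) (dataNC ℓ)).trans (NN_le_width _)

/-- Kitaev's layout has the width of the block. [folklore] -/
theorem layoutN_eq (ℓ : ℕ) : ℓ + (clNumControls ℓ + mWC ℓ) = totNC ℓ := by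
  have := dataN_le_totN ℓ; unfold mWC dataNC at *; omega

/-- There is a wire. [folklore] -/
theorem layoutN_pos (ℓ : ℕ) : 0 < ℓ + (clNumControls ℓ + mWC ℓ) := by
  rw [layoutN_eq]; exact (NN_pos eC MC _).trans_le (NN_le_width _)

/-- The clean block on `ℕ`-indexed wires (no constant suffix). [cite: Kitaev1995, §2.2 Lemma 1 (compute, copy, uncompute)] -/
def opsNC (ℓ : ℕ) : List (ClOp ℕ) := cleanOps eC MC (dataNC ℓ) []

/-- The block uses wires of the layout only. [folklore] -/
theorem opsN_lt (ℓ : ℕ) : ∀ op ∈ opsNC ℓ, ∀ i ∈ wiresOf op, i < ℓ + (clNumControls ℓ + mWC ℓ) := by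
  rw [layoutN_eq]; exact cleanOps_lt

/-- The clean block on the wires of the layout. [folklore] -/
def opsFinC (ℓ : ℕ) : List (ClOp (Fin (ℓ + (clNumControls ℓ + mWC ℓ)))) :=
  (opsNC ℓ).map (ClOp.map (finOf _ (layoutN_pos ℓ)))

/-- The re-indexed block is well formed. [folklore] -/
theorem opsFin_wf (ℓ : ℕ) : ∀ op ∈ opsFinC ℓ, op.WF := by
  intro op hop
  simp only [opsFinC, List.mem_map] at hop
  obtain ⟨op, hop, rfl⟩ := hop
  exact wf_map_finOf _ (opsN_lt ℓ op hop) (cleanOps_wf op hop)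

/-- **The block of Kitaev's class-group family**: the exact Clifford+T compilation of the clean
reversible block of the machine of `clBlockFn`. [cite: Kitaev1995, §2.2 Lemma 1, §4 p. 15] -/
def VC (ℓ : ℕ) : QCircuit cliffordT (ℓ + (clNumControls ℓ + mWC ℓ)) :=
  ⟨revCompile (toRevList (opsFinC ℓ) (opsFin_wf ℓ))⟩

/-- The block is oracle-free. [folklore] -/
theorem VC_isOracleFree (ℓ : ℕ) : (VC ℓ).IsOracleFree := revCompile_isOracleFree _

/-- The tableau input of the block on instance `w` and controls `c`. [folklore] -/
def inpOfC (w : List Bool) (c : QReg (clNumControls w.length)) : List Bool := w ++ List.ofFn c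

/-- The tableau input has length `dataNC`. [folklore] -/
theorem length_inpOf (w : List Bool) (c : QReg (clNumControls w.length)) : (inpOfC w c).length = dataNC w.length := by
  simp [inpOfC, dataNC]

/-- **The work register** of the block's output on `|w⟩|c⟩|0…0⟩`: the read-out code of
`clBlockFn (w ++ c)` on the result wires, zeros elsewhere. [folklore] -/
def resOfC (w : List Bool) (c : QReg (clNumControls w.length)) : QReg (mWC w.length) :=
  fun j => readOut eC MC (dataNC w.length) (clBlockFn (inpOfC w c)) (dataNC w.length + j)

/-- **Semantics of the block on basis inputs**: `VC |w⟩|c⟩|0^{mWC}⟩ = |w⟩|c⟩|resOfC w c⟩`.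
[cite: Kitaev1995, §2.2 Lemma 1] -/
theorem VC_mulVec_basisState (w : List Bool) (c : QReg (clNumControls w.length)) :
    (VC w.length).toMatrix 0 *ᵥ basisState (coinInput w.get c) = basisState (tri w.get c (resOfC w c)) := by
  rw [VC, revCompile_mulVec_basisState]
  congr 1
  have hM := MC_outputsWithin (inpOfC w c)
  rw [length_inpOf, inpOfC] at hM
  have hM' : MC.OutputsWithin ((w ++ List.ofFn c) ++ []) (clBlockFn (w ++ List.ofFn c))
      (Tn eC ((w ++ List.ofFn c).length + ([] : List Bool).length)) := by
    rw [List.append_nil, List.length_nil, Nat.add_zero]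
    rw [show dataNC w.length = (w ++ List.ofFn c).length by simp [dataNC]] at hM
    exact hM
  have key : ∀ q : Fin (w.length + (clNumControls w.length + mWC w.length)),
      revEval (toRevList (opsFinC w.length) (opsFin_wf w.length)) (coinInput w.get c) q =
        liftW (tri w.get c (resOfC w c)) q := by
    intro q
    rw [revEval_toRevList, opsFinC, clEval_map_finOf_apply _ _ (opsN_lt _), ModExpBlock.liftW_coinInput, opsNC,
      show dataNC w.length = (w ++ List.ofFn c).length by simp [dataNC], clEval_cleanOps _ _ _ hM', ModExpBlock.liftW_tri]
    dsimp only
    have hq := q.isLt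
    by_cases h1 : (q : ℕ) < w.length
    · rw [if_pos (by simp; omega), dif_pos h1, List.getD_append _ _ _ _ h1, List.getD_eq_getElem _ _ h1]; rfl
    rw [dif_neg h1]
    by_cases h2 : (q : ℕ) < w.length + clNumControls w.length
    · rw [if_pos (by simpa using h2), dif_pos h2, List.getD_append_right _ _ _ _ (not_lt.1 h1),
        List.getD_eq_getElem _ _ (by simp; omega), List.getElem_ofFn]
    · rw [if_neg (by simpa using h2), dif_neg h2, dif_pos hq, resOfC, inpOfC]
      simp only [List.length_append, List.length_ofFn, List.length_nil, Nat.add_zero, dataNC]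
      congr 1
      omega
  funext q
  rw [key, liftW_val]

/-- **The block machine on the block's tableau input** writes the coded list of the trial forms.
[cite: Kitaev1995, §4 p. 15] -/
theorem blockFn_inpOf (d : ℕ) (L : List (ℕ × ℤ × ℕ)) (c : QReg (clNumControls (encodeClInstance d L).length)) :
    clBlockFn (inpOfC (encodeClInstance d L) c) = rawE ClFP.formE ((List.range (clTrials (encodeClInstance d L).length)).map
      fun t => trialFormL (-(d : ℤ)) (L.map toForm) (encodeClInstance d L).length (List.ofFn c) t) :=
  clBlockFn_wellFormed d L (List.ofFn c) (by simp)

/-- The whole read-out of the block's output is determined by the work register. [folklore] -/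
theorem readOut_eq_of_resOf_eq {w : List Bool} {c c' : QReg (clNumControls w.length)} (h : resOfC w c = resOfC w c') :
    readOut eC MC (dataNC w.length) (clBlockFn (inpOfC w c)) = readOut eC MC (dataNC w.length) (clBlockFn (inpOfC w c')) := by
  funext i
  have hwid : totNC w.length = NN eC MC (dataNC w.length) + copyN eC MC (dataNC w.length) := rfl
  have hNN : dataNC w.length ≤ NN eC MC (dataNC w.length) := le_NN _
  by_cases h1 : i < dataNC w.length
  · rw [readOut, readOut, if_neg (by omega), if_neg (by omega)]
  · by_cases h2 : i < totNC w.length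
    · have := congrFun h ⟨i - dataNC w.length, by unfold mWC; omega⟩
      simp only [resOfC] at this
      rwa [show dataNC w.length + (i - dataNC w.length) = i by omega] at this
    · rw [readOut, readOut, if_neg (by omega), if_neg (by omega)]

/-- **The work register determines and is determined by the trial forms.**
[cite: Kitaev1995, §2.2 Lemma 1 (no garbage), §4 p. 15] -/
theorem resOf_eq_iff {d : ℕ} {L : List (ℕ × ℤ × ℕ)} (hinst : IsClInstance d L)
    (c c' : QReg (clNumControls (encodeClInstance d L).length)) :
    resOfC (encodeClInstance d L) c = resOfC (encodeClInstance d L) c' ↔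
      ∀ t, trialForm d L (encodeClInstance d L).length c t = trialForm d L (encodeClInstance d L).length c' t := by
  constructor
  · intro h t
    have hro := readOut_eq_of_resOf_eq h
    have h₁ := MC_outputsWithin (inpOfC (encodeClInstance d L) c)
    have h₂ := MC_outputsWithin (inpOfC (encodeClInstance d L) c')
    rw [length_inpOf] at h₁ h₂
    have hl := eq_of_readOut_eq (length_inpOf _ c) (length_inpOf _ c') h₁ h₂ hro
    rw [blockFn_inpOf d L c, blockFn_inpOf d L c'] at hl
    have hl' := List.map_eq_map_iff.1 (rawE_injective ClFP.formE_injective hl) t (List.mem_range.2 t.isLt)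
    rwa [trialFormL_eq_trialForm hinst, trialFormL_eq_trialForm hinst] at hl'
  · intro h
    have hl : clBlockFn (inpOfC (encodeClInstance d L) c) = clBlockFn (inpOfC (encodeClInstance d L) c') := by
      rw [blockFn_inpOf d L c, blockFn_inpOf d L c']
      refine congrArg (rawE ClFP.formE) (List.map_congr_left fun t ht => ?_)
      have hT : t < clTrials _ := List.mem_range.1 ht
      have := h ⟨t, hT⟩
      rwa [← trialFormL_eq_trialForm hinst, ← trialFormL_eq_trialForm hinst] at this
    funext j
    change readOut eC MC _ (clBlockFn (inpOfC _ c)) _ = readOut eC MC _ (clBlockFn (inpOfC _ c')) _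
    rw [hl]

/-- **The block of the class-group family is clean and separates exactly the trial forms**: on every
instance the work register of `VC` determines and is determined by the trial forms. [cite: Kitaev1995, §2.2 Lemma 1, §4 p. 15] -/
theorem block_spec (d : ℕ) (L : List (ℕ × ℤ × ℕ)) (hinst : IsClInstance d L) :
    ∃ R : QReg (clNumControls (encodeClInstance d L).length) → QReg (mWC (encodeClInstance d L).length),
      (∀ c, (VC (encodeClInstance d L).length).toMatrix 0 *ᵥ basisState (coinInput (encodeClInstance d L).get c) =
        basisState (tri (encodeClInstance d L).get c (R c))) ∧
      (∀ c c', R c = R c' ↔ ∀ t, trialForm d L (encodeClInstance d L).length c t = trialForm d L (encodeClInstance d L).length c' t) :=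
  ⟨resOfC (encodeClInstance d L), fun c => VC_mulVec_basisState _ c, fun c c' => resOf_eq_iff hinst c c'⟩

end ClBlock

end Literature.Computability.Cryptography.Hallgren2005

end
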